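import Summits.CriticalPhenomena.CardyFormulaZ2.Theses.CardyRotToConf
import Literature.Topology.PlaneTopology.Crosscut
import Summits.CriticalPhenomena.CardyFormulaZ2.Theorems.CardyRotToConfR2SymmetryUpgrade.Negative.SurgRoundGerm
import HarnessLib

/-!
# The normal ray of a round germ, its first exit and the chord
# (one-shot surgery for crux `CardyRotToConfR2SymmetryUpgrade`, stmt-CriticalPhenomena-0698)

`dir`, `rayPt`, `exitParam`, `chordCurve` and `isCrosscut_chord`: the straight chord of a round germ of a
Dobrushin domain is a crosscut from `a` to its exit point.
Negative lane: no Theses statement is asserted; overview in `Negative/OneShotSurgery.lean`.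
-/

noncomputable section

open Set Filter Topology Metric
open scoped ComplexConjugate

namespace Summit.CriticalPhenomena.CardyFormulaZ2.Theorems.CardyRotToConfR2SymmetryUpgrade.Negative

/-! ### The normal ray of a round germ, its first exit, and the chord -/

section Ray

open Literature.Probability.RandomPlanarGeometry Literature.Topology.PlaneTopology
open scoped unitInterval

variable {U : Set ℂ} {a m : ℂ}

/-- The unit vector from `a` towards `m`. [folklore] -/
def dir (a m : ℂ) : ℂ := (m - a) / ((‖m - a‖ : ℝ) : ℂ)

/-- `norm_dir`: norm dir (auxiliary lemma of the one-shot surgery; the statement is the specification). -/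
theorem norm_dir (h : m ≠ a) : ‖dir a m‖ = 1 := by
  have hne : ‖m - a‖ ≠ 0 := norm_ne_zero_iff.2 (sub_ne_zero.2 h)
  rw [dir, norm_div, Complex.norm_real, Real.norm_eq_abs, abs_of_nonneg (norm_nonneg _),
    div_self hne]

/-- `dir_ne_zero`: dir ne zero (auxiliary lemma of the one-shot surgery; the statement is the specification). -/
theorem dir_ne_zero (h : m ≠ a) : dir a m ≠ 0 :=
  norm_ne_zero_iff.1 (by rw [norm_dir h]; exact one_ne_zero)

/-- `m - a = ‖m - a‖ • dir a m`. [folklore] -/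
theorem sub_eq_norm_mul_dir (h : m ≠ a) : m - a = ((‖m - a‖ : ℝ) : ℂ) * dir a m := by
  have hne : ((‖m - a‖ : ℝ) : ℂ) ≠ 0 := by
    exact_mod_cast norm_ne_zero_iff.2 (sub_ne_zero.2 h)
  rw [dir, mul_div_cancel₀ _ hne]

/-- The point at distance `t` from `a` on the ray towards `m`. [folklore] -/
def rayPt (a m : ℂ) (t : ℝ) : ℂ := a + (t : ℂ) * dir a m

/-- `rayPt_zero`: rayPt zero (auxiliary lemma of the one-shot surgery; the statement is the specification). -/
theorem rayPt_zero : rayPt a m 0 = a := by simp [rayPt]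

/-- `continuous_rayPt`: continuous rayPt (auxiliary lemma of the one-shot surgery; the statement is the specification). -/
theorem continuous_rayPt : Continuous (rayPt a m) := by
  unfold rayPt; fun_prop

/-- `dist_rayPt`: dist rayPt (auxiliary lemma of the one-shot surgery; the statement is the specification). -/
theorem dist_rayPt (h : m ≠ a) (t : ℝ) : dist (rayPt a m t) a = |t| := by
  rw [rayPt, dist_eq_norm, add_sub_cancel_left, norm_mul, Complex.norm_real, Real.norm_eq_abs,
    norm_dir h, mul_one]

/-- `rayPt_injective`: rayPt injective (auxiliary lemma of the one-shot surgery; the statement is the specification). -/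
theorem rayPt_injective (h : m ≠ a) : Function.Injective (rayPt a m) := by
  intro s t hst
  have : (s : ℂ) * dir a m = (t : ℂ) * dir a m := by
    simpa [rayPt] using hst
  exact_mod_cast mul_right_cancel₀ (dir_ne_zero h) this

/-- Ray points at distance `t ∈ (0, 2‖m - a‖)` lie in the open disc of the germ. [folklore] -/
theorem rayPt_mem_disc (h : m ≠ a) {t : ℝ} (ht0 : 0 < t) (ht : t < 2 * ‖m - a‖) :
    rayPt a m t ∈ ball m (dist m a) := by
  have e : rayPt a m t - m = ((t - ‖m - a‖ : ℝ) : ℂ) * dir a m := by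
    have h1 := sub_eq_norm_mul_dir h
    rw [rayPt, Complex.ofReal_sub, sub_mul, ← h1]
    ring
  rw [mem_ball, dist_eq_norm, e, norm_mul, norm_dir h, mul_one, Complex.norm_real,
    Real.norm_eq_abs, dist_eq_norm, abs_sub_lt_iff]
  constructor <;> linarith

/-- The **exit parameter**: the infimum of the distances `t > 0` at which the ray leaves `U`.
[folklore] -/
def exitParam (U : Set ℂ) (a m : ℂ) : ℝ := sInf {t : ℝ | 0 < t ∧ rayPt a m t ∉ U}

variable (hU : IsOpen U) (hb : Bornology.IsBounded U) (hg : IsRoundGerm U a m)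
include hb hg

/-- The exit set is nonempty (the set is bounded). [folklore] -/
theorem exitSet_nonempty : {t : ℝ | 0 < t ∧ rayPt a m t ∉ U}.Nonempty := by
  obtain ⟨M, hM⟩ := hb.subset_ball a
  refine ⟨max M 1, lt_max_of_lt_right one_pos, fun hmem => ?_⟩
  have := hM hmem
  rw [mem_ball, dist_rayPt hg.ne, abs_of_pos (lt_max_of_lt_right one_pos)] at this
  exact absurd (le_max_left M 1) (not_le.2 this)

omit hb in
/-- Small positive parameters are not exit parameters (the germ disc lies in `U`). [folklore] -/
theorem exists_lower_bound_exitSet :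
    ∃ ρ > 0, ∀ t ∈ {t : ℝ | 0 < t ∧ rayPt a m t ∉ U}, ρ ≤ t := by
  obtain ⟨hne, r, hr, hUeq⟩ := hg
  refine ⟨min r (2 * ‖m - a‖), lt_min hr (by have := norm_pos_iff.2 (sub_ne_zero.2 hne); linarith),
    fun t ht => ?_⟩
  by_contra hlt
  rw [not_le] at hlt
  have h1 : rayPt a m t ∈ ball a r := by
    rw [mem_ball, dist_rayPt hne, abs_of_pos ht.1]
    exact hlt.trans_le (min_le_left _ _)
  have h2 : rayPt a m t ∈ ball m (dist m a) :=
    rayPt_mem_disc hne ht.1 (hlt.trans_le (min_le_right _ _))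
  have : rayPt a m t ∈ U ∩ ball a r := by rw [hUeq]; exact ⟨h2, h1⟩
  exact ht.2 this.1

/-- The exit parameter is positive. [folklore] -/
theorem exitParam_pos : 0 < exitParam U a m := by
  obtain ⟨ρ, hρ, hlow⟩ := exists_lower_bound_exitSet hg
  exact hρ.trans_le (le_csInf (exitSet_nonempty hb hg) hlow)

omit hb hg in
/-- Before the exit parameter the ray stays in `U`. [folklore] -/
theorem rayPt_mem_of_lt {t : ℝ} (ht0 : 0 < t) (ht : t < exitParam U a m) : rayPt a m t ∈ U := by
  by_contra hnot
  have : exitParam U a m ≤ t := csInf_le ⟨0, fun s hs => hs.1.le⟩ ⟨ht0, hnot⟩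
  exact absurd ht (not_lt.2 this)

include hU in
/-- The exit point is not in `U` (the complement is closed). [folklore] -/
theorem exitPt_notMem : rayPt a m (exitParam U a m) ∉ U := by
  have hmem : exitParam U a m ∈ closure {t : ℝ | 0 < t ∧ rayPt a m t ∉ U} :=
    csInf_mem_closure (exitSet_nonempty hb hg) ⟨0, fun s hs => hs.1.le⟩
  have hcl : closure {t : ℝ | 0 < t ∧ rayPt a m t ∉ U} ⊆ rayPt a m ⁻¹' Uᶜ :=
    closure_minimal (fun t ht => ht.2) (hU.isClosed_compl.preimage continuous_rayPt)
  exact hcl hmem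

include hU in
/-- The exit point lies on the frontier of `U`. [folklore] -/
theorem exitPt_mem_frontier : rayPt a m (exitParam U a m) ∈ frontier U := by
  rw [frontier_eq_closure_inter_closure]
  refine ⟨?_, subset_closure (exitPt_notMem hU hb hg)⟩
  -- limit of the interior ray points `rayPt t`, `t ↑ exitParam`
  have htend : Tendsto (rayPt a m) (𝓝[<] exitParam U a m) (𝓝 (rayPt a m (exitParam U a m))) :=
    (continuous_rayPt (a := a) (m := m)).continuousAt.tendsto.mono_left nhdsWithin_le_nhds
  refine mem_closure_of_tendsto htend ?_
  have hpos := exitParam_pos hb hg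
  filter_upwards [Ioo_mem_nhdsLT hpos] with t ht
  exact rayPt_mem_of_lt ht.1 ht.2

omit hb hg in
/-- The exit point differs from `a`. [folklore] -/
theorem rayPt_ne (h : m ≠ a) {t : ℝ} (ht : t ≠ 0) : rayPt a m t ≠ a := by
  intro heq
  have := dist_rayPt h t
  rw [heq, dist_self] at this
  exact ht (abs_eq_zero.1 this.symm)

omit hb hg

/-- **The chord**: the straight curve `s ↦ a + (s τ) dir a m` on `[0, 1]`. [folklore] -/
def chordCurve (a m : ℂ) (τ : ℝ) : Curve ℂ :=
  ⟨⟨fun s : I => rayPt a m ((s : ℝ) * τ), continuous_rayPt.comp (by fun_prop)⟩⟩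

/-- `chordCurve_apply`: chordCurve apply (auxiliary lemma of the one-shot surgery; the statement is the specification). -/
@[simp] theorem chordCurve_apply (τ : ℝ) (s : I) : chordCurve a m τ s = rayPt a m ((s : ℝ) * τ) := rfl

/-- `source_chordCurve`: source chordCurve (auxiliary lemma of the one-shot surgery; the statement is the specification). -/
theorem source_chordCurve (τ : ℝ) : (chordCurve a m τ).source = a := by
  simp [Curve.source_def, rayPt_zero]

/-- `target_chordCurve`: target chordCurve (auxiliary lemma of the one-shot surgery; the statement is the specification). -/
theorem target_chordCurve (τ : ℝ) : (chordCurve a m τ).target = rayPt a m τ := by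
  simp [Curve.target_def]

/-- The chord is injective (a simple curve) for `τ ≠ 0`. [folklore] -/
theorem injective_chordCurve (h : m ≠ a) {τ : ℝ} (hτ : τ ≠ 0) :
    Function.Injective (chordCurve a m τ) := by
  intro s t hst
  have := rayPt_injective h hst
  exact Subtype.ext (mul_right_cancel₀ hτ this)

/-- The trace of the chord is the segment from `a` to its endpoint. [folklore] -/
theorem range_chordCurve (τ : ℝ) : (chordCurve a m τ).range = segment ℝ a (rayPt a m τ) := by
  ext z
  rw [segment_eq_image_lineMap, Curve.mem_range]
  constructor
  · rintro ⟨s, rfl⟩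
    refine ⟨s, ⟨s.2.1, s.2.2⟩, ?_⟩
    rw [AffineMap.lineMap_apply_module, chordCurve_apply, rayPt, rayPt]
    push_cast
    simp only [Complex.real_smul]
    push_cast
    ring
  · rintro ⟨θ, hθ, rfl⟩
    refine ⟨⟨θ, hθ⟩, ?_⟩
    rw [AffineMap.lineMap_apply_module, chordCurve_apply, rayPt, rayPt]
    simp only [Complex.real_smul]
    push_cast
    ring

/-- Interior chord points lie in `U` when `τ` is the exit parameter. [folklore] -/
theorem chordCurve_mem (hb : Bornology.IsBounded U) (hg : IsRoundGerm U a m) {s : I}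
    (hs0 : 0 < (s : ℝ)) (hs1 : (s : ℝ) < 1) :
    chordCurve a m (exitParam U a m) s ∈ U := by
  rw [chordCurve_apply]
  have hpos := exitParam_pos hb hg
  exact rayPt_mem_of_lt (mul_pos hs0 hpos) (by nlinarith)

/-- **The chord of a round germ is a crosscut** of the Jordan domain `D` from `a = D.pt 0` to
its exit point `q`. [folklore] -/
theorem isCrosscut_chord (D : DobrushinDomain) (hg : IsRoundGerm D.carrier (D.pt 0) m) :
    D.IsCrosscut (chordCurve (D.pt 0) m (exitParam D.carrier (D.pt 0) m)).range (D.pt 0)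
      (rayPt (D.pt 0) m (exitParam D.carrier (D.pt 0) m)) := by
  have hpos := exitParam_pos D.isBounded hg
  have hq : rayPt (D.pt 0) m (exitParam D.carrier (D.pt 0) m) ≠ D.pt 0 :=
    rayPt_ne hg.ne hpos.ne'
  refine ⟨?_, D.pt_mem_frontier 0, exitPt_mem_frontier D.isOpen D.isBounded hg, hq.symm, ?_⟩
  · rw [range_chordCurve]
    exact IsSimpleArc.segment hq.symm
  · rw [range_chordCurve]
    rintro z ⟨hz, hne⟩
    rw [segment_eq_image_lineMap] at hz
    obtain ⟨θ, hθ, rfl⟩ := hz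
    have hθ0 : 0 < θ := by
      refine lt_of_le_of_ne hθ.1 ?_
      rintro rfl
      exact hne (Or.inl (by simp))
    have hθ1 : θ < 1 := by
      refine lt_of_le_of_ne hθ.2 ?_
      rintro rfl
      exact hne (Or.inr (by simp))
    have e : AffineMap.lineMap (D.pt 0) (rayPt (D.pt 0) m (exitParam D.carrier (D.pt 0) m)) θ =
        rayPt (D.pt 0) m (θ * exitParam D.carrier (D.pt 0) m) := by
      rw [AffineMap.lineMap_apply_module, rayPt, rayPt]
      simp only [Complex.real_smul]
      push_cast
      ring
    rw [e]
    exact rayPt_mem_of_lt (mul_pos hθ0 hpos) (by nlinarith)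

end Ray

end Summit.CriticalPhenomena.CardyFormulaZ2.Theorems.CardyRotToConfR2SymmetryUpgrade.Negative
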